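import Literature.NumberTheory.K2Lit.LocalDoublingEmbedding
import Literature.NumberTheory.K2Lit.SiegelEisensteinSeriesDoubled
import Literature.NumberTheory.K2Lit.DoubledUnitaryDegeneratePrincipalSeries
import Literature.NumberTheory.GelbartRogawski1991.DoubledWeilRepresentationLocalFamilyCM
import Literature.NumberTheory.GelbartRogawski1991.LocalDoubledUnitaryUnramifiedParabolic
import Literature.NumberTheory.GelbartRogawski1991.LocalDoubledUnitaryGoodPlace
import Literature.NumberTheory.Automorphic.HeckeCharacterLocalComponentSmooth
import HarnessLib

/-!
# The local Siegel character and the unramified local section `Λ_{s,v}` of the doubled group (leaf D7c of the LOCAL SEAM of s23)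

Topic `NumberTheory/K2Lit` (Track B build stream 29; SPEC-D7 `K2/K2Liu-plan/g0/SPEC-D7-LocalDoublingZeta.v1.K2Liu-plan-g0.md` §§2–3;
DEPMAP v2.1 `Cruxes/HLiu418/Lines/K2_Liu_LocalSeam_s23.md` §1 (a), §2 (LS1), file #22). Sibling of ★ `K2Lit/LocalDoublingEmbedding`
(`ι_v`) and ★ `K2Lit/LocalDoublingZeta` (`localZeta`, `doublingHeckeOp`, `zetaS`). Definitions with bodies and proved theorems only:
**no `sorry`, no named fact, no instance, no notation.** REUSE-FIRST: the local Siegel data are NOT re-defined — they are the ★ global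
ones of `K2Lit/SiegelEisensteinSeriesDoubled` (`siegelDelta`, `siegelDeltaCharacter`) read at the place inclusion ★
`GRConstruction.locToAdelic v = UnitaryGroup.inclPlaceAdelic v : H(L⁺_v) →* H(𝔸)`, and identified with the ★ GR91 local package
(`UnitaryDualPair.LocalSplitting.IsSiegelDelta ∕ detDelta ∕ chiDet`, ★ D1 `K2Lit/DoubledUnitaryDegeneratePrincipalSeries.localSiegelCharacter`)
through the ★ place-component bridges `DoubledUnitarySiegelPlaceComponents` (`isSiegelDelta_locToAdelic_iff`, `chiDet_locToAdelic`,
`modDelta_locToAdelic`).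

* §1 the δ-package of the K2Lit datum for the GR91 local API (all ★: `imagUnit`, `GRConstruction.gramR_isSymm ∕ hermD_eq_map_gramD`).
* §2 `siegelDeltaLoc v = P_Δ(L⁺_v) ≤ H(L⁺_v)` := ★ `siegelDelta.comap (locToAdelic v)`; block form (`mem_siegelDeltaLoc_iff_isSiegelM`) and the GR91
  Lagrangian form (`mem_siegelDeltaLoc_iff_local`); `siegelCharLoc χ v s u := ★ siegelDeltaCharacter χ s (locToAdelic v u)`
  (`= χ_v(det_Δ u)·|det_Δ u|_v^{s+n/2}`), multiplicative on `P_Δ(L⁺_v)`; **`siegelCharLoc_eq_localSiegelCharacter`**: on elements with unit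
  `det_Δ` it IS ★ D1's `localSiegelCharacter` for the family `χ_w := χ.localComponent w` (so D1's `localDegPS χ_v s` are its sections).
* §3 **unramified triviality**: `siegelCharLoc χ v s = 1` on `P_Δ(L⁺_v) ∩ K_{H,v}` when `χ` is unramified above `v` (★ `valuation_detDelta_eq_one`,
  ★ `IsUnramifiedAt.localComponent_eq_one_of_valuation_eq_one`).
* §4 the **unramified local section `LambdaLoc χ v s : H(L⁺_v) → ℂ`** (`Λ_{s,v}(p k) = siegelCharLoc χ v s p` for `p ∈ P_Δ(L⁺_v)`, `k ∈ K_{H,v}`,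
  junk `0` off `P_Δ·K_H`), WELL DEFINED by §3 (`siegelCharLoc_eq_of_decomp`); `LambdaLoc 1 = 1`, `= 1` on `K_{H,v}`, right `K_{H,v}`-invariance,
  left `P_Δ`-equivariance, and **`lambdaLoc_mem_localDegPS`**: `Λ_{s,v} ∈ I_v(s, χ_v)` = ★ D1 `localDegPS`. The local Iwasawa decomposition
  `H(L⁺_v) = P_Δ(L⁺_v)·K_{H,v}` (under which the junk branch is empty) is NOT defined or posited here: sockets take it as the explicit binder
  `∀ h, ∃ p ∈ siegelDeltaLoc … v, ∃ k ∈ UnitaryGroup.localInt … v, h = p * k` until the Cartan∕Iwasawa file (#26∕#27) proves it at good places.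

Degenerate corners: `n = 0` (`H_v` trivial, `Λ ≡ 1`); `χ` ramified above `v` (then §3∕§4 are not claimed — hypothesis
`hχ : ∀ w ∣ v, χ.IsUnramifiedAt w`); `h ∉ P_Δ·K_H` (junk `0`; empty under the local Iwasawa decomposition).
References: [Li1992, §3]; [GelbartPiatetskishapiroRallis1987, Part A §1, §6]; [HarrisKudlaSweet1996, §1 (1.11)–(1.15)]; [Kudla1994, §3];
[GelbartRogawski1991, §3.1 (3.1.2)–(3.1.3)]; [Liu2011, §2C p. 863].
-/

set_option autoImplicit false

noncomputable section

open scoped Matrix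
open NumberField IsDedekindDomain

namespace Literature.NumberTheory.K2Lit.SiegelDoubled

open Literature.NumberTheory.Automorphic Literature.NumberTheory.GaloisRepresentations
open Literature.NumberTheory.GelbartRogawski1991 Literature.NumberTheory.GelbartRogawski1991.GRConstruction
open Literature.NumberTheory.GelbartRogawski1991.UnitaryDualPair

variable (L : Type) [Field L] [NumberField L] [IsCMField L]
variable {N M n : ℕ} (e : Fin N × Fin M ≃ Fin n)
  (dV : Fin N → L) (hdV : ∀ i, IsCMField.complexConj L (dV i) = dV i)
  (dW : Fin M → L) (hdW : ∀ i, IsCMField.complexConj L (dW i) = dW i)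
  (v : HeightOneSpectrum (𝓞 (Fp L)))

/-! ## §1 The δ-package of the K2Lit datum for the GR91 local API

The GR91 local API (`UnitaryDualPair.LocalSplitting.*`, ★ D1) is keyed by `(hcδ, hδ, hd, hT₀, hJD)`; for the K2Lit datum these are
★ `complexConj_imagUnit L`, ★ `imagUnit_ne_zero L`, ★ `imagUnit_mul_self L`, ★ `GRConstruction.gramR_isSymm`, ★ `GRConstruction.hermD_eq_map_gramD`
(`DoubledWeilRepresentationLocalFamilyCM`) — reused by name below, nothing re-declared. -/

/-! ## §2 `P_Δ(L⁺_v)` and the local Siegel character, read through `locToAdelic v` -/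

/-- **`P_Δ(L⁺_v) ≤ H(L⁺_v)`**: the pull-back of ★ `siegelDelta = P_Δ(𝔸)` along the place inclusion ★ `locToAdelic v`.
[cite: Kudla1994, §3] [cite: HarrisKudlaSweet1996, §1 (1.11)] -/
def siegelDeltaLoc : Subgroup (UnitaryGroup.localPi L (IsCMField.complexConj L) (n + n) (hermD L e dV hdV dW hdW) v) :=
  (siegelDelta L e dV hdV dW hdW).comap (locToAdelic L e dV hdV dW hdW v)

/-- membership: `u ∈ P_Δ(L⁺_v) ↔ ι_v u ∈ P_Δ(𝔸)`. [cite: Kudla1994, §3] -/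
theorem mem_siegelDeltaLoc_iff (u : UnitaryGroup.localPi L (IsCMField.complexConj L) (n + n) (hermD L e dV hdV dW hdW) v) :
    u ∈ siegelDeltaLoc L e dV hdV dW hdW v ↔ IsSiegelDelta L e dV hdV dW hdW (locToAdelic L e dV hdV dW hdW v u) :=
  Iff.rfl

/-- membership, BLOCK FORM: `u ∈ P_Δ(L⁺_v) ↔` for every `w ∣ v` the `e₂`-blocks of `u_w` satisfy `u₁₁ + u₁₂ = u₂₁ + u₂₂`
(★ `isSiegelDelta_locToAdelic_iff`). [cite: Kudla1994, §3] [cite: HarrisKudlaSweet1996, §1 (1.11)] -/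
theorem mem_siegelDeltaLoc_iff_isSiegelM (u : UnitaryGroup.localPi L (IsCMField.complexConj L) (n + n) (hermD L e dV hdV dW hdW) v) :
    u ∈ siegelDeltaLoc L e dV hdV dW hdW v ↔
      ∀ w : UnitaryGroup.PlacesOver L v,
        IsSiegelM (((u : UnitaryGroup.LocalGLPi L (n + n) v) w : GL (Fin (n + n)) (w.1.adicCompletion L)) :
          Matrix (Fin (n + n)) (Fin (n + n)) (w.1.adicCompletion L)) :=
  isSiegelDelta_locToAdelic_iff L e dV hdV dW hdW v u

/-- membership, LAGRANGIAN FORM of the GR91 local package (★ `LocalSplitting.IsSiegelDelta` with `δ := imagUnit L`, `T₀ := gramR`):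
the two local Siegel conditions agree (★ `LocalSplitting.isSiegelDelta_iff_blocks`). [cite: Kudla1994, §3] [cite: HarrisKudlaSweet1996, §1 (1.11)] -/
theorem mem_siegelDeltaLoc_iff_local (u : UnitaryGroup.localPi L (IsCMField.complexConj L) (n + n) (hermD L e dV hdV dW hdW) v) :
    u ∈ siegelDeltaLoc L e dV hdV dW hdW v ↔
      LocalSplitting.IsSiegelDelta (Fp L) L (IsCMField.complexConj L) (complexConj_imagUnit L) (imagUnit_ne_zero L)
        (imagUnit_mul_self L) v n (gramR_isSymm L e dV hdV dW hdW) (hermD_eq_map_gramD L e dV hdV dW hdW) u := by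
  haveI : Algebra.IsQuadraticExtension (Fp L) L := IsCMField.isQuadraticExtension L
  rw [mem_siegelDeltaLoc_iff_isSiegelM, LocalSplitting.isSiegelDelta_iff_blocks]
  rfl

/-- **the local Siegel character `χ_v(det_Δ u)·|det_Δ u|_v^{s+n/2}`** := the ★ global `siegelDeltaCharacter χ s` read at `ι_v u`
(so its `χ_v` IS `(χ.localComponent w)_{w∣v}` and its modulus IS `∏_{w∣v} ‖det_Δ u_w‖_w^{1/2}`, ★ `chiDet_locToAdelic` ∕ ★ `modDelta_locToAdelic`).
[cite: HarrisKudlaSweet1996, §1 (1.15)] [cite: Liu2011, §2C p. 863] -/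
def siegelCharLoc (χ : HeckeCharacter L) (s : ℂ)
    (u : UnitaryGroup.localPi L (IsCMField.complexConj L) (n + n) (hermD L e dV hdV dW hdW) v) : ℂ :=
  siegelDeltaCharacter L e dV hdV dW hdW χ s (locToAdelic L e dV hdV dW hdW v u)

/-- unfolding. [cite: HarrisKudlaSweet1996, §1 (1.15)] -/
theorem siegelCharLoc_apply (χ : HeckeCharacter L) (s : ℂ)
    (u : UnitaryGroup.localPi L (IsCMField.complexConj L) (n + n) (hermD L e dV hdV dW hdW) v) :
    siegelCharLoc L e dV hdV dW hdW v χ s u = siegelDeltaCharacter L e dV hdV dW hdW χ s (locToAdelic L e dV hdV dW hdW v u) :=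
  rfl

/-- `siegelCharLoc χ v s 1 = 1`. [cite: HarrisKudlaSweet1996, §1 (1.15)] -/
theorem siegelCharLoc_one (χ : HeckeCharacter L) (s : ℂ) : siegelCharLoc L e dV hdV dW hdW v χ s 1 = 1 := by
  rw [siegelCharLoc, (locToAdelic L e dV hdV dW hdW v).map_one, siegelDeltaCharacter_one]

/-- the local Siegel character is multiplicative on `P_Δ(L⁺_v)` (★ `siegelDeltaCharacter_mul` at `ι_v`).
[cite: HarrisKudlaSweet1996, §1 (1.15)] -/
theorem siegelCharLoc_mul (χ : HeckeCharacter L) (s : ℂ)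
    {p q : UnitaryGroup.localPi L (IsCMField.complexConj L) (n + n) (hermD L e dV hdV dW hdW) v}
    (hp : p ∈ siegelDeltaLoc L e dV hdV dW hdW v) (hq : q ∈ siegelDeltaLoc L e dV hdV dW hdW v) :
    siegelCharLoc L e dV hdV dW hdW v χ s (p * q) =
      siegelCharLoc L e dV hdV dW hdW v χ s p * siegelCharLoc L e dV hdV dW hdW v χ s q := by
  rw [siegelCharLoc, (locToAdelic L e dV hdV dW hdW v).map_mul p q, siegelDeltaCharacter_mul L e dV hdV dW hdW χ s hp hq]
  rfl

/-- inverses on `P_Δ(L⁺_v)`: `siegelCharLoc p⁻¹ · siegelCharLoc p = 1`. [cite: HarrisKudlaSweet1996, §1 (1.15)] -/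
theorem siegelCharLoc_inv_mul (χ : HeckeCharacter L) (s : ℂ)
    {p : UnitaryGroup.localPi L (IsCMField.complexConj L) (n + n) (hermD L e dV hdV dW hdW) v}
    (hp : p ∈ siegelDeltaLoc L e dV hdV dW hdW v) :
    siegelCharLoc L e dV hdV dW hdW v χ s p⁻¹ * siegelCharLoc L e dV hdV dW hdW v χ s p = 1 := by
  rw [← siegelCharLoc_mul L e dV hdV dW hdW v χ s (inv_mem hp) hp, inv_mul_cancel, siegelCharLoc_one]

/-- `det_Δ` of the GR91 local package IS `detDeltaM` of the component matrix (definitional). [cite: Kudla1994, §3] -/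
theorem localDetDelta_eq_detDeltaM (w : UnitaryGroup.PlacesOver L v)
    (u : UnitaryGroup.localPi L (IsCMField.complexConj L) (n + n) (hermD L e dV hdV dW hdW) v) :
    LocalSplitting.detDelta (Fp L) L (IsCMField.complexConj L) v n w u =
      detDeltaM (((u : UnitaryGroup.LocalGLPi L (n + n) v) w : GL (Fin (n + n)) (w.1.adicCompletion L)) :
        Matrix (Fin (n + n)) (Fin (n + n)) (w.1.adicCompletion L)) :=
  rfl

/-- **consistency with ★ D1**: where every `det_Δ(u_w)` is a unit (e.g. on `P_Δ(L⁺_v)`), the local Siegel character IS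
`localSiegelCharacter (Fp L) L c v n (χ.localComponent ·) s u = χ_v(det_Δ u)·|det_Δ u|_v^{s+n/2}` of ★ `K2Lit/DoubledUnitaryDegeneratePrincipalSeries`
(so the degenerate principal series ★ `localDegPS` there is the space of sections for `siegelCharLoc`). [cite: HarrisKudlaSweet1996, §1 (1.15)] [cite: Liu2021, §B.3 p. 101] -/
theorem siegelCharLoc_eq_localSiegelCharacter (χ : HeckeCharacter L) (s : ℂ)
    (u : UnitaryGroup.localPi L (IsCMField.complexConj L) (n + n) (hermD L e dV hdV dW hdW) v)
    (hu : ∀ w : UnitaryGroup.PlacesOver L v, IsUnit (LocalSplitting.detDelta (Fp L) L (IsCMField.complexConj L) v n w u)) :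
    siegelCharLoc L e dV hdV dW hdW v χ s u =
      LocalSiegelDoubled.localSiegelCharacter (Fp L) L (IsCMField.complexConj L) v n (fun w => χ.localComponent w.1) s u := by
  have hloc : ∀ w : UnitaryGroup.PlacesOver L v,
      IsUnit (detDeltaM (((u : UnitaryGroup.LocalGLPi L (n + n) v) w : GL (Fin (n + n)) (w.1.adicCompletion L)) :
        Matrix (Fin (n + n)) (Fin (n + n)) (w.1.adicCompletion L))) := hu
  -- the modulus: `(∏ √‖d_w‖)^(2s+n) = (∏ ‖d_w‖)^(s + n/2)`
  set A : ℝ := LocalSiegelDoubled.absDetDelta (Fp L) L (IsCMField.complexConj L) v n u with hA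
  have hA0 : 0 ≤ A := LocalSiegelDoubled.absDetDelta_nonneg (Fp L) L (IsCMField.complexConj L) v n u
  have hsqrt : (∏ w : UnitaryGroup.PlacesOver L v,
      Real.sqrt ‖detDeltaM (((u : UnitaryGroup.LocalGLPi L (n + n) v) w : GL (Fin (n + n)) (w.1.adicCompletion L)) :
        Matrix (Fin (n + n)) (Fin (n + n)) (w.1.adicCompletion L))‖) = Real.sqrt A := by
    symm
    rw [Real.sqrt_eq_iff_eq_sq hA0 (Finset.prod_nonneg fun _ _ => Real.sqrt_nonneg _), ← Finset.prod_pow, hA,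
      LocalSiegelDoubled.absDetDelta]
    exact Finset.prod_congr rfl fun w _ => by rw [Real.sq_sqrt (norm_nonneg _)]; rfl
  have him : (Complex.log (A : ℂ) * (((1 / 2 : ℝ) : ℂ))).im = 0 := by
    rw [Complex.mul_im, Complex.log_im, Complex.arg_ofReal_of_nonneg hA0, Complex.ofReal_im, Complex.ofReal_re]
    ring
  have hmod : (((∏ w : UnitaryGroup.PlacesOver L v,
      Real.sqrt ‖detDeltaM (((u : UnitaryGroup.LocalGLPi L (n + n) v) w : GL (Fin (n + n)) (w.1.adicCompletion L)) :
        Matrix (Fin (n + n)) (Fin (n + n)) (w.1.adicCompletion L))‖ : ℝ) : ℂ) ^ (2 * s + (n : ℂ))) =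
      ((A : ℝ) : ℂ) ^ (s + (n : ℂ) / 2) := by
    rw [hsqrt, Real.sqrt_eq_rpow, Complex.ofReal_cpow hA0, ← Complex.cpow_mul _ (by rw [him]; exact neg_lt_zero.2 Real.pi_pos)
      (by rw [him]; exact Real.pi_pos.le)]
    congr 1
    push_cast
    ring
  rw [siegelCharLoc, siegelDeltaCharacter, chiDet_locToAdelic_eq_prod_dite L e dV hdV dW hdW v χ u hloc,
    modDelta_locToAdelic L e dV hdV dW hdW v u hloc, hmod, LocalSiegelDoubled.localSiegelCharacter]
  rfl


/-- on `P_Δ(L⁺_v)` every `det_Δ(u_w)` is a unit (★ adelic `isUnit_detDelta_of_isSiegelDelta` at `ι_v u`, ★ `isUnit_detDelta_locToAdelic_iff`).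
[cite: Kudla1994, §3] -/
theorem isUnit_localDetDelta_of_mem_siegelDeltaLoc
    {u : UnitaryGroup.localPi L (IsCMField.complexConj L) (n + n) (hermD L e dV hdV dW hdW) v}
    (hu : u ∈ siegelDeltaLoc L e dV hdV dW hdW v) (w : UnitaryGroup.PlacesOver L v) :
    IsUnit (LocalSplitting.detDelta (Fp L) L (IsCMField.complexConj L) v n w u) :=
  (isUnit_detDelta_locToAdelic_iff L e dV hdV dW hdW v u).1 (isUnit_detDelta_of_isSiegelDelta L e dV hdV dW hdW _ hu) w

/-- **on `P_Δ(L⁺_v)` the local Siegel character IS ★ D1's `localSiegelCharacter`** (unit hypothesis discharged).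
[cite: HarrisKudlaSweet1996, §1 (1.15)] [cite: Liu2021, §B.3 p. 101] -/
theorem siegelCharLoc_eq_localSiegelCharacter_of_mem (χ : HeckeCharacter L) (s : ℂ)
    {u : UnitaryGroup.localPi L (IsCMField.complexConj L) (n + n) (hermD L e dV hdV dW hdW) v}
    (hu : u ∈ siegelDeltaLoc L e dV hdV dW hdW v) :
    siegelCharLoc L e dV hdV dW hdW v χ s u =
      LocalSiegelDoubled.localSiegelCharacter (Fp L) L (IsCMField.complexConj L) v n (fun w => χ.localComponent w.1) s u :=
  siegelCharLoc_eq_localSiegelCharacter L e dV hdV dW hdW v χ s u (isUnit_localDetDelta_of_mem_siegelDeltaLoc L e dV hdV dW hdW v hu)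

/-! ## §3 Unramified triviality on `P_Δ(L⁺_v) ∩ K_{H,v}` -/

/-- on `P_Δ(L⁺_v) ∩ H(𝒪_v)` every `det_Δ(u_w)` has valuation `1` (★ `LocalSplitting.valuation_detDelta_eq_one` at the δ-package).
[cite: GelbartRogawski1991, §3.1 (3.1.3)] [cite: Kudla1994, §3] -/
theorem valuation_localDetDelta_eq_one
    {u : UnitaryGroup.localPi L (IsCMField.complexConj L) (n + n) (hermD L e dV hdV dW hdW) v}
    (hu : u ∈ siegelDeltaLoc L e dV hdV dW hdW v)
    (hk : u ∈ UnitaryGroup.localInt L (IsCMField.complexConj L) (n + n) (hermD L e dV hdV dW hdW) v)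
    (w : UnitaryGroup.PlacesOver L v) :
    ValuativeRel.valuation (w.1.adicCompletion L) (LocalSplitting.detDelta (Fp L) L (IsCMField.complexConj L) v n w u) = 1 := by
  haveI : Algebra.IsQuadraticExtension (Fp L) L := IsCMField.isQuadraticExtension L
  exact LocalSplitting.valuation_detDelta_eq_one (Fp L) L (IsCMField.complexConj L) (complexConj_imagUnit L)
    (imagUnit_ne_zero L) (imagUnit_mul_self L) v n (gramR_isSymm L e dV hdV dW hdW) (hermD_eq_map_gramD L e dV hdV dW hdW) w
    ((UnitaryGroup.mem_localInt_iff L (IsCMField.complexConj L) (n + n) (hermD L e dV hdV dW hdW) v u).1 hk w)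
    ((mem_siegelDeltaLoc_iff_local L e dV hdV dW hdW v u).1 hu)

/-- … hence norm `1`. [cite: GelbartRogawski1991, §3.1 (3.1.3)] -/
theorem norm_localDetDelta_eq_one
    {u : UnitaryGroup.localPi L (IsCMField.complexConj L) (n + n) (hermD L e dV hdV dW hdW) v}
    (hu : u ∈ siegelDeltaLoc L e dV hdV dW hdW v)
    (hk : u ∈ UnitaryGroup.localInt L (IsCMField.complexConj L) (n + n) (hermD L e dV hdV dW hdW) v)
    (w : UnitaryGroup.PlacesOver L v) :
    ‖LocalSplitting.detDelta (Fp L) L (IsCMField.complexConj L) v n w u‖ = 1 := by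
  have h := valuation_localDetDelta_eq_one L e dV hdV dW hdW v hu hk w
  rw [LocalSplitting.valuation_eq_one_iff_valued] at h
  rw [NumberField.FinitePlace.norm_def, h, map_one, NNReal.coe_one]

/-- **`siegelCharLoc χ v s = 1` on `P_Δ(L⁺_v) ∩ K_{H,v}` for `χ` unramified above `v`** (`χ_w(det_Δ u_w) = 1` by ★
`IsUnramifiedAt.localComponent_eq_one_of_valuation_eq_one`, `‖det_Δ u_w‖_w = 1`) — the parabolic half of the unramified clause, which makes the
unramified section of §4 well defined. [cite: GelbartRogawski1991, §3.1 (3.1.2)–(3.1.3)] [cite: Li1992, §3] -/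
theorem siegelCharLoc_eq_one_of_mem_localInt (χ : HeckeCharacter L) (s : ℂ)
    (hχ : ∀ w : UnitaryGroup.PlacesOver L v, χ.IsUnramifiedAt w.1)
    {u : UnitaryGroup.localPi L (IsCMField.complexConj L) (n + n) (hermD L e dV hdV dW hdW) v}
    (hu : u ∈ siegelDeltaLoc L e dV hdV dW hdW v)
    (hk : u ∈ UnitaryGroup.localInt L (IsCMField.complexConj L) (n + n) (hermD L e dV hdV dW hdW) v) :
    siegelCharLoc L e dV hdV dW hdW v χ s u = 1 := by
  have hloc : ∀ w : UnitaryGroup.PlacesOver L v,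
      IsUnit (detDeltaM (((u : UnitaryGroup.LocalGLPi L (n + n) v) w : GL (Fin (n + n)) (w.1.adicCompletion L)) :
        Matrix (Fin (n + n)) (Fin (n + n)) (w.1.adicCompletion L))) :=
    isUnit_localDetDelta_of_mem_siegelDeltaLoc L e dV hdV dW hdW v hu
  have h1 : (∏ w : UnitaryGroup.PlacesOver L v, χ.localComponent w.1 (hloc w).unit) = 1 :=
    Finset.prod_eq_one fun w _ =>
      (hχ w).localComponent_eq_one_of_valuation_eq_one (by
        rw [IsUnit.unit_spec]
        exact valuation_localDetDelta_eq_one L e dV hdV dW hdW v hu hk w)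
  have h2 : (∏ w : UnitaryGroup.PlacesOver L v,
      Real.sqrt ‖detDeltaM (((u : UnitaryGroup.LocalGLPi L (n + n) v) w : GL (Fin (n + n)) (w.1.adicCompletion L)) :
        Matrix (Fin (n + n)) (Fin (n + n)) (w.1.adicCompletion L))‖) = 1 :=
    Finset.prod_eq_one fun w _ => by
      rw [← localDetDelta_eq_detDeltaM, norm_localDetDelta_eq_one L e dV hdV dW hdW v hu hk w, Real.sqrt_one]
  rw [siegelCharLoc, siegelDeltaCharacter, chiDet_locToAdelic L e dV hdV dW hdW v χ u hloc,
    modDelta_locToAdelic L e dV hdV dW hdW v u hloc, h1, h2, Units.val_one, Complex.ofReal_one, Complex.one_cpow, mul_one]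

/-! ## §4 The unramified local section `Λ_{s,v}` -/

/-- `h = p · k` with `p ∈ P_Δ(L⁺_v)`, `k ∈ K_{H,v}` (the decompositions `Λ_{s,v}` is defined on). [cite: Li1992, §3] -/
def IsSiegelIntDecomp (h : UnitaryGroup.localPi L (IsCMField.complexConj L) (n + n) (hermD L e dV hdV dW hdW) v)
    (pk : UnitaryGroup.localPi L (IsCMField.complexConj L) (n + n) (hermD L e dV hdV dW hdW) v ×
      UnitaryGroup.localPi L (IsCMField.complexConj L) (n + n) (hermD L e dV hdV dW hdW) v) : Prop :=
  pk.1 ∈ siegelDeltaLoc L e dV hdV dW hdW v ∧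
    pk.2 ∈ UnitaryGroup.localInt L (IsCMField.complexConj L) (n + n) (hermD L e dV hdV dW hdW) v ∧ h = pk.1 * pk.2

/-- **independence of the decomposition**: `p k = p' k'` (`p, p' ∈ P_Δ`, `k, k' ∈ K_H`) ⇒ `siegelCharLoc p = siegelCharLoc p'` for `χ`
unramified above `v` (`p'⁻¹ p = k' k⁻¹ ∈ P_Δ ∩ K_H`, §3). [cite: Li1992, §3] [cite: GelbartPiatetskishapiroRallis1987, Part A §1] -/
theorem siegelCharLoc_eq_of_decomp (χ : HeckeCharacter L) (s : ℂ)
    (hχ : ∀ w : UnitaryGroup.PlacesOver L v, χ.IsUnramifiedAt w.1)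
    {p k p' k' : UnitaryGroup.localPi L (IsCMField.complexConj L) (n + n) (hermD L e dV hdV dW hdW) v}
    (hp : p ∈ siegelDeltaLoc L e dV hdV dW hdW v)
    (hk : k ∈ UnitaryGroup.localInt L (IsCMField.complexConj L) (n + n) (hermD L e dV hdV dW hdW) v)
    (hp' : p' ∈ siegelDeltaLoc L e dV hdV dW hdW v)
    (hk' : k' ∈ UnitaryGroup.localInt L (IsCMField.complexConj L) (n + n) (hermD L e dV hdV dW hdW) v)
    (heq : p * k = p' * k') :
    siegelCharLoc L e dV hdV dW hdW v χ s p = siegelCharLoc L e dV hdV dW hdW v χ s p' := by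
  have h1 : p = p' * (k' * k⁻¹) := by rw [← mul_assoc, ← heq, mul_inv_cancel_right]
  have hq : p'⁻¹ * p = k' * k⁻¹ := inv_mul_eq_of_eq_mul h1
  have hqP : p'⁻¹ * p ∈ siegelDeltaLoc L e dV hdV dW hdW v := mul_mem (inv_mem hp') hp
  have hqK : p'⁻¹ * p ∈ UnitaryGroup.localInt L (IsCMField.complexConj L) (n + n) (hermD L e dV hdV dW hdW) v := by
    rw [hq]; exact mul_mem hk' (inv_mem hk)
  have hone := siegelCharLoc_eq_one_of_mem_localInt L e dV hdV dW hdW v χ s hχ hqP hqK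
  calc siegelCharLoc L e dV hdV dW hdW v χ s p
      = siegelCharLoc L e dV hdV dW hdW v χ s (p' * (p'⁻¹ * p)) := by rw [mul_inv_cancel_left]
    _ = siegelCharLoc L e dV hdV dW hdW v χ s p' * siegelCharLoc L e dV hdV dW hdW v χ s (p'⁻¹ * p) :=
        siegelCharLoc_mul L e dV hdV dW hdW v χ s hp' hqP
    _ = siegelCharLoc L e dV hdV dW hdW v χ s p' := by rw [hone, mul_one]

open scoped Classical in
/-- **the unramified local Siegel section `Λ_{s,v} : H(L⁺_v) → ℂ`**: `Λ_{s,v}(p k) = χ_v(det_Δ p)|det_Δ p|_v^{s+n/2}` for `p ∈ P_Δ(L⁺_v)`,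
`k ∈ K_{H,v}` (well defined by `siegelCharLoc_eq_of_decomp` when `χ` is unramified above `v`), junk `0` off `P_Δ·K_H` (empty under
the local Iwasawa decomposition `H(L⁺_v) = P_Δ(L⁺_v)·K_{H,v}`). The `K_{H,v}`-spherical vector of the local degenerate principal series `I_v(s, χ_v)`, normalised by `Λ_{s,v}(1) = 1`.
[cite: Li1992, §3] [cite: GelbartPiatetskishapiroRallis1987, Part A §6] [cite: Liu2011, §2C (2-4) p. 863] -/
def LambdaLoc (χ : HeckeCharacter L) (s : ℂ)
    (h : UnitaryGroup.localPi L (IsCMField.complexConj L) (n + n) (hermD L e dV hdV dW hdW) v) : ℂ :=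
  if hh : ∃ pk, IsSiegelIntDecomp L e dV hdV dW hdW v h pk
    then siegelCharLoc L e dV hdV dW hdW v χ s (Classical.choose hh).1 else 0

/-- **`Λ_{s,v}(p k) = siegelCharLoc χ v s p`** for `p ∈ P_Δ(L⁺_v)`, `k ∈ K_{H,v}`, `χ` unramified above `v`. [cite: Li1992, §3] -/
theorem lambdaLoc_mul_eq (χ : HeckeCharacter L) (s : ℂ) (hχ : ∀ w : UnitaryGroup.PlacesOver L v, χ.IsUnramifiedAt w.1)
    {p k : UnitaryGroup.localPi L (IsCMField.complexConj L) (n + n) (hermD L e dV hdV dW hdW) v}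
    (hp : p ∈ siegelDeltaLoc L e dV hdV dW hdW v)
    (hk : k ∈ UnitaryGroup.localInt L (IsCMField.complexConj L) (n + n) (hermD L e dV hdV dW hdW) v) :
    LambdaLoc L e dV hdV dW hdW v χ s (p * k) = siegelCharLoc L e dV hdV dW hdW v χ s p := by
  classical
  have hh : ∃ pk, IsSiegelIntDecomp L e dV hdV dW hdW v (p * k) pk := ⟨(p, k), hp, hk, rfl⟩
  rw [LambdaLoc, dif_pos hh]
  obtain ⟨hp', hk', heq⟩ := Classical.choose_spec hh
  exact (siegelCharLoc_eq_of_decomp L e dV hdV dW hdW v χ s hχ hp hk hp' hk' heq).symm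

/-- off `P_Δ·K_H` the junk value is `0`. [cite: Li1992, §3] -/
theorem lambdaLoc_eq_zero (χ : HeckeCharacter L) (s : ℂ)
    {h : UnitaryGroup.localPi L (IsCMField.complexConj L) (n + n) (hermD L e dV hdV dW hdW) v}
    (hh : ¬ ∃ pk, IsSiegelIntDecomp L e dV hdV dW hdW v h pk) : LambdaLoc L e dV hdV dW hdW v χ s h = 0 := by
  classical
  rw [LambdaLoc, dif_neg hh]

/-- **`Λ_{s,v}(1) = 1`.** [cite: Li1992, §3] -/
theorem lambdaLoc_one (χ : HeckeCharacter L) (s : ℂ) (hχ : ∀ w : UnitaryGroup.PlacesOver L v, χ.IsUnramifiedAt w.1) :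
    LambdaLoc L e dV hdV dW hdW v χ s 1 = 1 := by
  have h := lambdaLoc_mul_eq L e dV hdV dW hdW v χ s hχ (one_mem (siegelDeltaLoc L e dV hdV dW hdW v))
    (one_mem (UnitaryGroup.localInt L (IsCMField.complexConj L) (n + n) (hermD L e dV hdV dW hdW) v))
  rwa [mul_one, siegelCharLoc_one] at h

/-- **`Λ_{s,v}` on `P_Δ(L⁺_v)`**: `Λ_{s,v}(p) = siegelCharLoc χ v s p`. [cite: Li1992, §3] -/
theorem lambdaLoc_of_mem_siegelDeltaLoc (χ : HeckeCharacter L) (s : ℂ) (hχ : ∀ w : UnitaryGroup.PlacesOver L v, χ.IsUnramifiedAt w.1)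
    {p : UnitaryGroup.localPi L (IsCMField.complexConj L) (n + n) (hermD L e dV hdV dW hdW) v}
    (hp : p ∈ siegelDeltaLoc L e dV hdV dW hdW v) :
    LambdaLoc L e dV hdV dW hdW v χ s p = siegelCharLoc L e dV hdV dW hdW v χ s p := by
  have h := lambdaLoc_mul_eq L e dV hdV dW hdW v χ s hχ hp
    (one_mem (UnitaryGroup.localInt L (IsCMField.complexConj L) (n + n) (hermD L e dV hdV dW hdW) v))
  rwa [mul_one] at h

/-- **`Λ_{s,v}` on `K_{H,v}`**: `Λ_{s,v}(k) = 1` — the `K_{H,v}`-SPHERICAL normalisation. [cite: Li1992, §3] [cite: Liu2011, §2C (2-4) p. 863] -/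
theorem lambdaLoc_of_mem_localInt (χ : HeckeCharacter L) (s : ℂ) (hχ : ∀ w : UnitaryGroup.PlacesOver L v, χ.IsUnramifiedAt w.1)
    {k : UnitaryGroup.localPi L (IsCMField.complexConj L) (n + n) (hermD L e dV hdV dW hdW) v}
    (hk : k ∈ UnitaryGroup.localInt L (IsCMField.complexConj L) (n + n) (hermD L e dV hdV dW hdW) v) :
    LambdaLoc L e dV hdV dW hdW v χ s k = 1 := by
  have h := lambdaLoc_mul_eq L e dV hdV dW hdW v χ s hχ (one_mem (siegelDeltaLoc L e dV hdV dW hdW v)) hk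
  rwa [one_mul, siegelCharLoc_one] at h

/-- **right `K_{H,v}`-invariance**: `Λ_{s,v}(h k) = Λ_{s,v}(h)`. [cite: Li1992, §3] -/
theorem lambdaLoc_mul_localInt (χ : HeckeCharacter L) (s : ℂ) (hχ : ∀ w : UnitaryGroup.PlacesOver L v, χ.IsUnramifiedAt w.1)
    (h : UnitaryGroup.localPi L (IsCMField.complexConj L) (n + n) (hermD L e dV hdV dW hdW) v)
    {k : UnitaryGroup.localPi L (IsCMField.complexConj L) (n + n) (hermD L e dV hdV dW hdW) v}
    (hk : k ∈ UnitaryGroup.localInt L (IsCMField.complexConj L) (n + n) (hermD L e dV hdV dW hdW) v) :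
    LambdaLoc L e dV hdV dW hdW v χ s (h * k) = LambdaLoc L e dV hdV dW hdW v χ s h := by
  by_cases hh : ∃ pk, IsSiegelIntDecomp L e dV hdV dW hdW v h pk
  · obtain ⟨⟨p, k₀⟩, hp, hk₀, rfl⟩ := hh
    rw [lambdaLoc_mul_eq L e dV hdV dW hdW v χ s hχ hp hk₀, mul_assoc,
      lambdaLoc_mul_eq L e dV hdV dW hdW v χ s hχ hp (mul_mem hk₀ hk)]
  · have hh' : ¬ ∃ pk, IsSiegelIntDecomp L e dV hdV dW hdW v (h * k) pk := by
      rintro ⟨⟨p, k'⟩, hp, hk', heq⟩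
      exact hh ⟨(p, k' * k⁻¹), hp, mul_mem hk' (inv_mem hk), by rw [← mul_assoc, ← heq, mul_inv_cancel_right]⟩
    rw [lambdaLoc_eq_zero L e dV hdV dW hdW v χ s hh, lambdaLoc_eq_zero L e dV hdV dW hdW v χ s hh']

/-- **left `P_Δ(L⁺_v)`-equivariance**: `Λ_{s,v}(p h) = siegelCharLoc χ v s p · Λ_{s,v}(h)` — `Λ_{s,v}` is a Siegel section.
[cite: Li1992, §3] [cite: HarrisKudlaSweet1996, §1 (1.15)] -/
theorem lambdaLoc_siegel_mul (χ : HeckeCharacter L) (s : ℂ) (hχ : ∀ w : UnitaryGroup.PlacesOver L v, χ.IsUnramifiedAt w.1)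
    {p : UnitaryGroup.localPi L (IsCMField.complexConj L) (n + n) (hermD L e dV hdV dW hdW) v}
    (hp : p ∈ siegelDeltaLoc L e dV hdV dW hdW v)
    (h : UnitaryGroup.localPi L (IsCMField.complexConj L) (n + n) (hermD L e dV hdV dW hdW) v) :
    LambdaLoc L e dV hdV dW hdW v χ s (p * h) = siegelCharLoc L e dV hdV dW hdW v χ s p * LambdaLoc L e dV hdV dW hdW v χ s h := by
  by_cases hh : ∃ pk, IsSiegelIntDecomp L e dV hdV dW hdW v h pk
  · obtain ⟨⟨p₀, k⟩, hp₀, hk, rfl⟩ := hh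
    rw [lambdaLoc_mul_eq L e dV hdV dW hdW v χ s hχ hp₀ hk, ← mul_assoc,
      lambdaLoc_mul_eq L e dV hdV dW hdW v χ s hχ (mul_mem hp hp₀) hk, siegelCharLoc_mul L e dV hdV dW hdW v χ s hp hp₀]
  · have hh' : ¬ ∃ pk, IsSiegelIntDecomp L e dV hdV dW hdW v (p * h) pk := by
      rintro ⟨⟨p', k⟩, hp', hk, heq⟩
      exact hh ⟨(p⁻¹ * p', k), mul_mem (inv_mem hp) hp', hk, by rw [mul_assoc, ← heq, inv_mul_cancel_left]⟩
    rw [lambdaLoc_eq_zero L e dV hdV dW hdW v χ s hh, lambdaLoc_eq_zero L e dV hdV dW hdW v χ s hh', mul_zero]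

set_option maxHeartbeats 400000 in
/-- **`Λ_{s,v} ∈ I_v(s, χ_v)`**: the unramified local section is a smooth Siegel section — a member of ★ D1's degenerate principal series
`localDegPS (Fp L) L c δ… v n T₀… (χ.localComponent ·) s` (δ-package of §1). [cite: HarrisKudlaSweet1996, §1 (1.15)] [cite: Liu2021, §B.3 p. 101] [cite: Li1992, §3] -/
theorem lambdaLoc_mem_localDegPS (χ : HeckeCharacter L) (s : ℂ) (hχ : ∀ w : UnitaryGroup.PlacesOver L v, χ.IsUnramifiedAt w.1) :
    LambdaLoc L e dV hdV dW hdW v χ s ∈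
      LocalSiegelDoubled.localDegPS (Fp L) L (IsCMField.complexConj L) (complexConj_imagUnit L) (imagUnit_ne_zero L)
        (imagUnit_mul_self L) v n (gramR_isSymm L e dV hdV dW hdW) (hermD_eq_map_gramD L e dV hdV dW hdW)
        (fun w => χ.localComponent w.1) s := by
  haveI : Algebra.IsQuadraticExtension (Fp L) L := IsCMField.isQuadraticExtension L
  refine ⟨fun p hp h => ?_, ?_⟩
  · have hp' : p ∈ siegelDeltaLoc L e dV hdV dW hdW v := (mem_siegelDeltaLoc_iff_local L e dV hdV dW hdW v p).2 hp
    rw [lambdaLoc_siegel_mul L e dV hdV dW hdW v χ s hχ hp' h, siegelCharLoc_eq_localSiegelCharacter_of_mem L e dV hdV dW hdW v χ s hp']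
  · refine ⟨⟨UnitaryGroup.localInt L (IsCMField.complexConj L) (n + n) (hermD L e dV hdV dW hdW) v,
      UnitaryGroup.isOpen_localInt L (IsCMField.complexConj L) (n + n) (hermD L e dV hdV dW hdW) v⟩, fun h u hu => ?_⟩
    exact lambdaLoc_mul_localInt L e dV hdV dW hdW v χ s hχ h hu

end Literature.NumberTheory.K2Lit.SiegelDoubled

end
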